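import Summits.KontsevichZagierPeriods.Zeta5Search.Certificates.VIML3Final
import Summits.KontsevichZagierPeriods.Zeta5Search.Certificates.VIML3BridgeNK
import Summits.KontsevichZagierPeriods.Zeta5Search.Certificates.ModRedLNKAll
import HarnessLib

/-!
# ζ(5) search — brown9 LEVEL 3 closed: `VIMLeadingRecurrence` holds (cell `pub-zeta5`, certifier `cert-1`)

HONEST FRAMING: systematic search; recurrence certificates; no irrationality claim unless certified.

The last input of the level-3 replay is discharged: the lane's `n`-shift relation (L-NK) of the triple sum `L` is now a
tree theorem for every level `n ≥ 6` and every rational `k₃` (`VIMInner.ModRed.L_rel_NK_all`: cert-2 g3's kernel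
coordinate sum + cert-1 g3's re-attachment, endpoint reduction and assembly), its coefficient data agree with `muQ··`
(`VIML3BridgeNK`) and the two seats' triple sums agree definitionally (`VIML3BridgeK3.ModRed_Lsum_eq`). Hence
`LNKAt_holds`, and with `VIML3Final.vimLeadingRecurrence_of_LNK`:

**`vimLeadingRecurrence_holds : VIMLeadingRecurrence`** — the cell's typed target
`Families.CellularVIMRecurrenceLaws.VIMLeadingRecurrence` (fam-brown9: the order-4, degree-19 operator `P` annihilates
the leading coefficients `A(n)` of Brown's "vanishing in the middle" cellular family for ALL `n`) is PROVED, sorry-free,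
from the 6-fold binomial sum alone: three nested levels of creative telescoping (level 1 `T`, level 2 `R`/`L`, level 3
the `k₃`-sum), every certificate replayed in the kernel. What this is NOT: it says nothing about irrationality — it is the
recurrence half of the programme (the arithmetic/denominator and growth halves are separate cell items).

INDEPENDENT CROSS-CHECK (not part of the proof; bookkeeping added by cert-1 g5, 2026-08-21, relay ttrl3 l.1666): the
`zeta5-calc` compute lane later delivered its own exact level-3 certificate by a second pipeline (modular sampling at 19
primes + CRT/rational lift, kit job j114210, 486/486 coefficients lifted; lane files `run/shared/lean/ttrl/zeta5-calc/brown9/VIM.md`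
sha256 `a1184340…`, `r1c/L3_certificate.json` sha256 `97039d44…`): telescoper `η_i = P_i·ℓ` with `P` =
`Families.CellularVIMRecurrenceLaws.P` VERBATIM and six module coordinates that coincide, as rational functions of `(n, k₃)`
after clearing the two normalisations (`ℓ = (n+1)⁶(n+2)⁶(n+3)³`), with the certificate replayed here (`VIML3CertM00…M21`;
identification by fam-brown9 g6, `families/brown9/FAMILY.md` §16.3-ter). It is cited as a cross-check of this theorem, never
as its proof: the proof of record is the kernel term below.
-/

namespace Summit.KontsevichZagierPeriods.Zeta5Search.Certificates

namespace VIMInner.L3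

open Families.CellularVIMRecurrenceLaws (VIMLeadingRecurrence)

/-- **(L-NK) holds** at every level `n ≥ 6` (`ModRed.L_rel_NK_all`), in the form used by the level-3 replay. -/
theorem LNKAt_holds (n : ℕ) (hn : 6 ≤ n) : LNKAt n := by
  intro x
  have h := ModRed.L_rel_NK_all n hn x
  rw [etaM10_muQ10, etaM00_muQ00, etaM01_muQ01, etaM02_muQ02] at h
  exact h

/-- **LEVEL 3 of the brown9 programme, unconditionally**: the cell's order-4 recurrence `Σ_i P_i(n) A(n+i) = 0` holds for
every `n` — `Families.CellularVIMRecurrenceLaws.VIMLeadingRecurrence`. -/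
theorem vimLeadingRecurrence_holds : VIMLeadingRecurrence :=
  vimLeadingRecurrence_of_LNK fun m hm => LNKAt_holds m (by omega)

end VIMInner.L3

end Summit.KontsevichZagierPeriods.Zeta5Search.Certificates
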